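import Summits.AtomisticToContinuum.HydrodynamicLimit.Theorems.OneFlightGossipEngineEnergyCurrentTailsLevelCensusObjects
import Literature.Analysis.FluidPDE.CollisionalTransfer
import Literature.MathematicalPhysics.KineticTheory.HardSphereTwoTimePressure
import HarnessLib

/-!
# The crossing ledger of the level census (stub A (i) of the line `level-census-comparison`,
# crux `EnergyCurrentTails`, stmt-AtomisticToContinuum-9235)

Helper file of the registered stub `stub_censusLedger : CensusLedger` (objects and statement in
`…Theorems.OneFlightGossipEngineEnergyCurrentTailsLevelCensusObjects`).  It proves part (i) of
`CensusLedger`, the EXACT CROSSING LEDGER of the expected level census along the deterministic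
hard-sphere flow: for `0 < σ < 1/2`, every `N`, every flow `Φ`, every level `E` and `s ≤ s'`,

  `levelCensus s' E + eventCount s s' (downEvent E) = levelCensus s E + eventCount s s' (upEvent E)`

in `ℝ≥0∞` (registered helper `censusLedger_identity`).

**Proof.**  Pure kinematics + Tonelli, after the landed twin `…QuarticLedger` (stub L of the line
`quartic-schur-ledger`).  Along a hard-sphere trajectory the real level count
`F_E(w) = #{k : E < ‖(w k).2‖²}` is constant on free flights (`freeFlight_apply`), so the weak
balance law `IsHardSphereTrajectory.sub_eq_integral_add_collisionalTransfer` (streaming derivative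
`0`; no continuity of `F_E` is needed) gives `F_E(γ s') − F_E(γ s) = collisionalTransfer`, the sum
of the jumps of `F_E` at the collision times in `(s, s']`.  At a binary collision only the pair
jumps (`apply_eq_leftLim_apply_of_ne`), so the jump is
`κ_E = aboveCount E (v⁺) − aboveCount E (v⁻)` of the record of the ordered contact pair `(i, j)`,
`i < j` (`contactPairs_eq_pair`: the two ordered pairs of one collision, the guard `fst < snd`
keeps one; `ofConfig_preVel_eq_leftLim`, `ofConfig_postVel`), and conservation of the pair's
kinetic energy (`ofConfig_norm_sq_preVel`) forces `κ_E ∈ {−1, 0, 1}`, i.e.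
`κ_E = 𝟙_{upEvent E} − 𝟙_{downEvent E}`.  Hence the pathwise ledger
`#_{s'} + #down = #_s + #up` in `ℕ`, cast to `ℝ≥0∞`; it integrates by `lintegral_add_left`
(measurability of the census integrand only, `HardSphereFlow.measurable_flow`) and
`lintegral_congr_ae` over the `λ_N`-conull good set (`ae_mem_good_localGibbsLaw`).  No
integrability of the collision counts is needed.

References: Cercignani–Illner–Pulvirenti 1994 §4.2 (elastic collisions along the flow);
Gamba–Panferov–Villani 2009 (level-crossing bookkeeping behind comparison principles).
-/

noncomputable section

open MeasureTheory Set Filter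
open scoped ENNReal InnerProductSpace

namespace Summit.AtomisticToContinuum.HydrodynamicLimit.Theorems.EnergyCurrentTailsLevelCensus

open Literature.MathematicalPhysics.KineticTheory Literature.Analysis.FluidPDE

/-! ## One collision: the count above a level moves by `-1`, `0` or `+1` -/

/-- **`κ_E ∈ {−1, 0, 1}`.**  If two pairs of velocities have the same kinetic energy (an elastic
collision), the change of the number of velocities above the level `E` is
`𝟙{count went up} − 𝟙{count went down}`: energy conservation forbids `±2`. [folklore] -/
theorem aboveCount_sub_eq_ite (E : ℝ) {p q : V3 × V3}
    (hpq : ‖q.1‖ ^ 2 + ‖q.2‖ ^ 2 = ‖p.1‖ ^ 2 + ‖p.2‖ ^ 2) :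
    (aboveCount E q : ℝ) - aboveCount E p =
      (if aboveCount E p < aboveCount E q then (1 : ℝ) else 0) -
        (if aboveCount E q < aboveCount E p then (1 : ℝ) else 0) := by
  simp only [aboveCount]
  by_cases h1 : E < ‖p.1‖ ^ 2 <;> by_cases h2 : E < ‖p.2‖ ^ 2 <;>
    by_cases h3 : E < ‖q.1‖ ^ 2 <;> by_cases h4 : E < ‖q.2‖ ^ 2 <;>
    simp only [h1, h2, h3, h4, if_true, if_false] <;> norm_num <;> linarith

/-- A collision sum commutes with additive monoid homomorphisms (finitely many collision times in
the window). [folklore] -/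
theorem map_collisionSum {M M' : Type*} [AddCommMonoid M] [AddCommMonoid M'] {d X : Type*}
    [Fintype d] {n : ℕ} {G : Geometry d X} {ε : ℝ} {γ : ℝ → Config n d X} {S : Set ℝ}
    (hfin : (collisionTimes G ε γ ∩ S).Finite) (φ : M →+ M')
    (F : HardSphereCollisionRecord d X n → M) :
    φ (collisionSum G ε γ S F) = collisionSum G ε γ S (fun c => φ (F c)) := by
  rw [collisionSum_eq_finset_sum hfin, collisionSum_eq_finset_sum hfin, map_sum]
  exact Finset.sum_congr rfl fun t _ => map_sum φ _ _

/-- Casting a natural-number-valued collision sum into an `AddCommMonoidWithOne` (e.g. `ℝ`,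
`ℝ≥0∞`) gives the collision sum of the casts. [folklore] -/
theorem natCast_collisionSum {M : Type*} [AddCommMonoidWithOne M] {d X : Type*} [Fintype d]
    {n : ℕ} {G : Geometry d X} {ε : ℝ} {γ : ℝ → Config n d X} {S : Set ℝ}
    (hfin : (collisionTimes G ε γ ∩ S).Finite) (F : HardSphereCollisionRecord d X n → ℕ) :
    ((collisionSum G ε γ S F : ℕ) : M) = collisionSum G ε γ S (fun c => (F c : M)) :=
  map_collisionSum hfin (Nat.castAddMonoidHom M) F

/-! ## Along one hard-sphere trajectory -/

section Trajectory

variable {X : Type*} [TopologicalSpace X] [T2Space X] {n : ℕ} {G : Geometry (Fin 3) X} {ε : ℝ}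
  {γ : ℝ → Config n (Fin 3) X}

/-- **The jump of the level count at a binary collision.**  At a collision of the ordered contact
pair `(i, j)` only the pair's velocities jump, so the jump of `w ↦ #{k : E < ‖(w k).2‖²}` is
`aboveCount E (v_i⁺, v_j⁺) − aboveCount E (v_i⁻, v_j⁻)` read off the collision record
(`ofConfig_postVel`, `ofConfig_preVel_eq_leftLim`). [folklore] -/
theorem collisionJump_levelCount (h : IsHardSphereTrajectory G ε n γ) (E : ℝ) {t : ℝ}
    {i j : Fin n} (hp : (i, j) ∈ contactPairs G ε (γ t)) :
    collisionJump (fun w : Config n (Fin 3) X => ∑ k, if E < ‖(w k).2‖ ^ 2 then (1 : ℝ) else 0)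
        γ t =
      (aboveCount E (HardSphereCollisionRecord.ofConfig G ε (γ t) t i j).postVel : ℝ) -
        aboveCount E (HardSphereCollisionRecord.ofConfig G ε (γ t) t i j).preVel := by
  obtain ⟨hij, hc⟩ := mem_contactPairs.1 hp
  rw [h.ofConfig_preVel_eq_leftLim hp, HardSphereCollisionRecord.ofConfig_postVel]
  have hdiff : collisionJump
      (fun w : Config n (Fin 3) X => ∑ k, if E < ‖(w k).2‖ ^ 2 then (1 : ℝ) else 0) γ t =
      ∑ k, ((if E < ‖(γ t k).2‖ ^ 2 then (1 : ℝ) else 0) -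
        (if E < ‖(Function.leftLim γ t k).2‖ ^ 2 then (1 : ℝ) else 0)) := by
    simp only [collisionJump, Finset.sum_sub_distrib]
  rw [hdiff, Fintype.sum_eq_add i j hij]
  · simp only [aboveCount]
    push_cast
    ring
  · intro k hk
    rw [h.apply_eq_leftLim_apply_of_ne hij hc hk.1 hk.2, sub_self]

/-- **The collisional transfer of the level count is the once-per-collision sum of `κ_E`.**  In a
regular geometry the ordered contact pairs of one collision are `(i, j)` and `(j, i)`; the guard
`fst < snd` keeps exactly one of them, and that record carries the whole jump
`κ_E = aboveCount E v⁺ − aboveCount E v⁻`. [folklore] -/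
theorem collisionalTransfer_levelCount_eq_collisionSum (h : IsHardSphereTrajectory G ε n γ)
    (hG : G.IsHardSphereRegular ε) (E a b : ℝ) :
    collisionalTransfer G ε
        (fun w : Config n (Fin 3) X => ∑ k, if E < ‖(w k).2‖ ^ 2 then (1 : ℝ) else 0) γ a b =
      collisionSum G ε γ (Ioc a b) fun c =>
        if c.fst < c.snd then (aboveCount E c.postVel : ℝ) - aboveCount E c.preVel else 0 := by
  rw [collisionalTransfer, collisionSum_eq_collisionPairSum, collisionPairSum]
  refine finsum_mem_congr rfl fun t ht => ?_
  -- the ordered contact pair `(i, j)` with `i < j`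
  obtain ⟨⟨p, q⟩, hpq⟩ := mem_collisionTimes_iff_contactPairs_nonempty.1 ht.1
  have hne : p ≠ q := (mem_contactPairs.1 hpq).1
  obtain ⟨i, j, hij, hp⟩ : ∃ i j : Fin n, i < j ∧ (i, j) ∈ contactPairs G ε (γ t) := by
    rcases lt_or_gt_of_ne hne with hlt | hgt
    · exact ⟨p, q, hlt, hpq⟩
    · exact ⟨q, p, hgt, (swap_mem_contactPairs_iff hG).2 hpq⟩
  have hne' : (i, j) ≠ (j, i) := fun h' => hij.ne (Prod.mk.inj h').1
  rw [h.contactPairs_eq_pair hG hp, Finset.sum_pair hne']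
  simp only [HardSphereCollisionRecord.ofConfig_fst, HardSphereCollisionRecord.ofConfig_snd,
    if_pos hij, if_neg (not_lt.2 hij.le), add_zero]
  exact collisionJump_levelCount h E hp

/-- **The pathwise crossing ledger (natural numbers).**  Along a hard-sphere trajectory in a
regular geometry, for `a ≤ b`:
`#{k : E < ‖v_k(b)‖²} + #{down-crossings at E in (a, b]} = #{k : E < ‖v_k(a)‖²} + #{up-crossings}`,
each physical collision counted once (guard `fst < snd`).  The weak balance law with vanishing
streaming derivative, the jump `κ_E` of one collision, and `κ_E = 𝟙_{up} − 𝟙_{down}`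
(`aboveCount_sub_eq_ite`, energy conservation in the pair). [folklore] -/
theorem levelCount_add_downCount_eq (h : IsHardSphereTrajectory G ε n γ)
    (hG : G.IsHardSphereRegular ε) (E : ℝ) {a b : ℝ} (hab : a ≤ b) :
    (∑ k, if E < ‖(γ b k).2‖ ^ 2 then (1 : ℕ) else 0) +
        collisionSum G ε γ (Ioc a b) (fun c => if c.fst < c.snd then
          (if aboveCount E c.postVel < aboveCount E c.preVel then (1 : ℕ) else 0) else 0) =
      (∑ k, if E < ‖(γ a k).2‖ ^ 2 then (1 : ℕ) else 0) +
        collisionSum G ε γ (Ioc a b) (fun c => if c.fst < c.snd then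
          (if aboveCount E c.preVel < aboveCount E c.postVel then (1 : ℕ) else 0) else 0) := by
  -- the weak balance law for the real level count, streaming derivative `0`
  have hF : ∀ (z : Config n (Fin 3) X) (t : ℝ), HasDerivAt
      (fun s => ∑ k, if E < ‖(freeFlight G s z k).2‖ ^ 2 then (1 : ℝ) else 0) (0 : ℝ) t := by
    intro z t
    have hc : (fun s => ∑ k, if E < ‖(freeFlight G s z k).2‖ ^ 2 then (1 : ℝ) else 0) =
        fun _ => ∑ k, if E < ‖(z k).2‖ ^ 2 then (1 : ℝ) else 0 :=
      funext fun s => Finset.sum_congr rfl fun k _ => if_congr (by rw [freeFlight_apply]) rfl rfl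
    rw [hc]
    exact hasDerivAt_const t _
  have hbal := (h.sub_eq_integral_add_collisionalTransfer
    (F := fun w : Config n (Fin 3) X => ∑ k, if E < ‖(w k).2‖ ^ 2 then (1 : ℝ) else 0)
    (F' := fun _ : Config n (Fin 3) X => (0 : ℝ))
    hG.continuous_translate_left hF (fun _ => continuous_const) hab).2
  simp only [intervalIntegral.integral_zero, zero_add] at hbal
  rw [collisionalTransfer_levelCount_eq_collisionSum h hG E a b] at hbal
  -- `κ_E = 𝟙_{up} − 𝟙_{down}` termwise, in `ℝ`
  have hfin := h.finite_collisionTimes_inter_Ioc a b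
  have hκ : collisionSum G ε γ (Ioc a b) (fun c =>
        if c.fst < c.snd then (aboveCount E c.postVel : ℝ) - aboveCount E c.preVel else 0) =
      ((collisionSum G ε γ (Ioc a b) (fun c => if c.fst < c.snd then
          (if aboveCount E c.preVel < aboveCount E c.postVel then (1 : ℕ) else 0) else 0) : ℕ) :
          ℝ) -
      ((collisionSum G ε γ (Ioc a b) (fun c => if c.fst < c.snd then
          (if aboveCount E c.postVel < aboveCount E c.preVel then (1 : ℕ) else 0) else 0) : ℕ) :
          ℝ) := by
    rw [natCast_collisionSum hfin, natCast_collisionSum hfin, collisionSum_eq_finset_sum hfin,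
      collisionSum_eq_finset_sum hfin, collisionSum_eq_finset_sum hfin, ← Finset.sum_sub_distrib]
    refine Finset.sum_congr rfl fun t _ => ?_
    rw [← Finset.sum_sub_distrib]
    refine Finset.sum_congr rfl fun p _ => ?_
    by_cases hlt : (HardSphereCollisionRecord.ofConfig G ε (γ t) t p.1 p.2).fst <
        (HardSphereCollisionRecord.ofConfig G ε (γ t) t p.1 p.2).snd
    · rw [if_pos hlt, if_pos hlt, if_pos hlt]
      push_cast
      exact aboveCount_sub_eq_ite E
        (HardSphereCollisionRecord.ofConfig_norm_sq_preVel G ε (γ t) t p.1 p.2).symm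
    · rw [if_neg hlt, if_neg hlt, if_neg hlt]
      simp
  rw [hκ] at hbal
  -- read the real identity in `ℕ`
  have hcast : (((∑ k, if E < ‖(γ b k).2‖ ^ 2 then (1 : ℕ) else 0) +
        collisionSum G ε γ (Ioc a b) (fun c => if c.fst < c.snd then
          (if aboveCount E c.postVel < aboveCount E c.preVel then (1 : ℕ) else 0) else 0) : ℕ) :
          ℝ) =
      (((∑ k, if E < ‖(γ a k).2‖ ^ 2 then (1 : ℕ) else 0) +
        collisionSum G ε γ (Ioc a b) (fun c => if c.fst < c.snd then
          (if aboveCount E c.preVel < aboveCount E c.postVel then (1 : ℕ) else 0) else 0) : ℕ) :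
          ℝ) := by
    push_cast
    linarith
  exact_mod_cast hcast

end Trajectory

/-! ## Along the flow: the integrated ledger -/

/-- Measurability of the census integrand `z ↦ ∑ᵢ 𝟙{E < ‖vᵢ(r)‖²}` along a hard-sphere flow
(each `Φ.flow r` is measurable). [folklore] -/
theorem measurable_levelCount_flow {N : ℕ} {ε : ℝ}
    (Φ : HardSphereFlow (Torus.geometry (Fin 3)) ε (N + 1)) (r E : ℝ) :
    Measurable fun z : Config (N + 1) (Fin 3) T3 => ∑ i : Fin (N + 1),
      Set.indicator {v : V3 | E < ‖v‖ ^ 2} (fun _ => (1 : ℝ≥0∞)) ((Φ.flow r z i).2) := by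
  refine Finset.measurable_sum _ fun i _ => ?_
  have hS : MeasurableSet {v : V3 | E < ‖v‖ ^ 2} :=
    measurableSet_lt measurable_const (measurable_norm.pow_const 2)
  exact (measurable_const.indicator hS).comp
    ((measurable_pi_apply i).comp (Φ.measurable_flow r)).snd

/-- **The pathwise ledger on the good set, in `ℝ≥0∞`.**  For `z ∈ Φ.good` (regular torus geometry)
and `s ≤ s'`:
`∑ᵢ 𝟙{E < ‖vᵢ(s')‖²} + eventSum (downEvent E) = ∑ᵢ 𝟙{E < ‖vᵢ(s)‖²} + eventSum (upEvent E)`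
(the natural-number ledger `levelCount_add_downCount_eq`, cast). [folklore] -/
theorem levelCount_add_eventSum_eq {σ : ℝ} {N : ℕ} (Φ : Flow σ N)
    (hG : (Torus.geometry (Fin 3)).IsHardSphereRegular (hsDiameter σ N))
    {z : Config (N + 1) (Fin 3) T3} (hz : z ∈ Φ.good) (E : ℝ) {s s' : ℝ} (hss' : s ≤ s') :
    (∑ i : Fin (N + 1),
        Set.indicator {v : V3 | E < ‖v‖ ^ 2} (fun _ => (1 : ℝ≥0∞)) ((Φ.flow s' z i).2)) +
      eventSum Φ s s' (downEvent E) z =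
    (∑ i : Fin (N + 1),
        Set.indicator {v : V3 | E < ‖v‖ ^ 2} (fun _ => (1 : ℝ≥0∞)) ((Φ.flow s z i).2)) +
      eventSum Φ s s' (upEvent E) z := by
  have hγ := Φ.isTrajectory z hz
  have hfin := hγ.finite_collisionTimes_inter_Ioc s s'
  have hled := congrArg (Nat.cast : ℕ → ℝ≥0∞) (levelCount_add_downCount_eq hγ hG E hss')
  -- identify the four casts
  have hcount : ∀ r : ℝ, (∑ i : Fin (N + 1),
      Set.indicator {v : V3 | E < ‖v‖ ^ 2} (fun _ => (1 : ℝ≥0∞)) ((Φ.flow r z i).2)) =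
      ((∑ k, if E < ‖(Φ.flow r z k).2‖ ^ 2 then (1 : ℕ) else 0 : ℕ) : ℝ≥0∞) := by
    intro r
    push_cast
    refine Finset.sum_congr rfl fun i _ => ?_
    simp only [Set.indicator_apply, Set.mem_setOf_eq]
  have hevent : ∀ (P : VelEvent → Prop) [DecidablePred P] (S : Set VelEvent), S = {q | P q} →
      eventSum Φ s s' S z = ((Φ.collisionSum (Ioc s s') (fun c => if c.fst < c.snd then
        (if P (c.preVel, c.postVel) then (1 : ℕ) else 0) else 0) z : ℕ) : ℝ≥0∞) := by
    intro P _ S hS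
    subst hS
    rw [eventSum, HardSphereFlow.collisionSum_eq, HardSphereFlow.collisionSum_eq,
      natCast_collisionSum hfin]
    refine congrArg _ (funext fun c => ?_)
    simp only [Set.indicator_apply, Set.mem_setOf_eq, Nat.cast_ite, Nat.cast_one, Nat.cast_zero]
  rw [hcount s', hcount s,
    hevent (fun q => aboveCount E q.2 < aboveCount E q.1) (downEvent E) rfl,
    hevent (fun q => aboveCount E q.1 < aboveCount E q.2) (upEvent E) rfl]
  push_cast at hled ⊢
  simpa only [HardSphereFlow.collisionSum_eq] using hled

/-- **Registered helper `censusLedger_identity` — THE CROSSING LEDGER (stub A (i)).**  For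
`0 < σ < 1/2`, every `N`, every flow `Φ` of the crux frame, every level `E` and `s ≤ s'`:
`n_{s'}(E) + E#{down-crossings at E in (s, s']} = n_s(E) + E#{up-crossings at E in (s, s']}` in
`ℝ≥0∞` — the pathwise ledger `levelCount_add_eventSum_eq` on the `λ_N`-conull good set
(`ae_mem_good_localGibbsLaw`; regular torus geometry since `hsDiameter σ N ≤ σ < 1/2`),
integrated by `lintegral_add_left` (measurability of the census integrand only) and
`lintegral_congr_ae`. [folklore] -/
theorem censusLedger_identity :
    ∀ (a₀ θ₀ : T3 → ℝ) (u₀ : T3 → V3) (σ : ℝ), 0 < σ → σ < 1 / 2 →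
      ∀ (N : ℕ) (Φ : Flow σ N) (s s' E : ℝ), s ≤ s' →
        levelCensus σ a₀ θ₀ u₀ N Φ s' E + eventCount σ a₀ θ₀ u₀ N Φ s s' (downEvent E) =
          levelCensus σ a₀ θ₀ u₀ N Φ s E + eventCount σ a₀ θ₀ u₀ N Φ s s' (upEvent E) := by
  intro a₀ θ₀ u₀ σ hσ hσ2 N Φ s s' E hss'
  have hε : hsDiameter σ N < 2⁻¹ := (hsDiameter_le hσ.le N).trans_lt (by linarith)
  have hG : (Torus.geometry (Fin 3)).IsHardSphereRegular (hsDiameter σ N) :=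
    Torus.isHardSphereRegular_geometry hε
  unfold levelCensus eventCount
  rw [← lintegral_add_left (measurable_levelCount_flow Φ s' E),
    ← lintegral_add_left (measurable_levelCount_flow Φ s E)]
  refine lintegral_congr_ae ?_
  filter_upwards [ae_mem_good_localGibbsLaw σ a₀ u₀ θ₀ N Φ] with z hz
  exact levelCount_add_eventSum_eq Φ hG hz E hss'

end Summit.AtomisticToContinuum.HydrodynamicLimit.Theorems.EnergyCurrentTailsLevelCensus
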